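import Literature.AnabelianGeometry.EtaleTheta.Discharge.Sec1ThetaOrbitModelChi
import Literature.AnabelianGeometry.EtaleTheta.Discharge.Sec1Thm110ModelChiNV
import Literature.AnabelianGeometry.EtaleTheta.Discharge.Sec1Thm110ClosuresModelChi
import Literature.AnabelianGeometry.EtaleTheta.Discharge.Sec1StandardType
import Literature.AnabelianGeometry.EtaleTheta.SettingModelChiThetaCocycleSec
import Literature.AnabelianGeometry.EtaleTheta.StandardEnvOfSetting
import Literature.AnabelianGeometry.EtaleTheta.ContH1ConjAction
import Literature.AnabelianGeometry.EtaleTheta.ContH1Discrete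
import HarnessLib

/-!
# [EtTh] Def. 2.7 "orbits of standard type" (FACT-LIST F-0573) DECIDED NON-VACUOUSLY at the Kummer-carrying χ-model
# `MuTwoSetting.modelχ`: the universal closure is FALSE; an instance HOLDS at the model's own theta class

S. Mochizuki, *The étale theta function …*, Publ. RIMS **45** (2009) [MochizukiEtTh2009], §2, Def. 2.7, PRIMS PDF
p. 41 (printed 267): "If `η̈^{Θ,ℤ}` is of standard type, then we shall also refer to `η̈^{Θ,l·ℤ}`, `η̲̈^{Θ,l·ℤ}`,
`η̈^{Θ,l·ℤ×μ₂}`, `η̲̈^{Θ,l·ℤ×μ₂}`, `η̈^{Θ,ℤ×μ₂}` as being of standard type"; §1, Def. 1.9 (i)/(ii), p. 29.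
[cite: MochizukiEtTh2009, Def 2.7 p.41]

PROOF-ONLY companion (abc-iut cell, block F, seat abc-iut-f-132 gen 4; FACT-LIST row **F-0573**
`MuTwoSetting.OrbitsOfStandardType`, typer abc-iut-L2-t8 `StandardEnvOfSetting.lean`; no `def`, no instance, no
`Prop` fact). Gen 0 of this base (`Discharge/Sec2Def27OrbitsOfStandardType`, p432488) could certify the row only
VACUOUSLY (the root model has no étale theta data). This sequel decides it at `M := MuTwoSetting.modelχ p`
(`Π^tp_X = Γ ⋊_χ G_{ℚ_p}`, `K = K̈ = ℚ_p`), consuming BY NAME abc-iut-f-113's `MuTwoSetting.modelχ`, `epsZχ`,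
`exists_eq_mul_zpow_of_inclX_mem_dotX`, `conj_inflTheta_kumYdd_modelχ`, `valuesAt_eq_singleton_of_thetaOrbit_eq`,
abc-iut-L2-t6's `kummerDataχSec` / `etaleThetaDataχSec` / `nonCuspidalPointχ`, abc-iut-L2-d1's `etaDdχ`,
`thetaCocycleχ`, `Huuχ`, `doubleUnderlineχOfEtaRes`, `doubleUnderlineχSec`, abc-iut-w5-d140's `sqrtNegOneχ`.
* (NEG) **the ∀-closure is FALSE, non-vacuously.** For `E_c := etaleThetaDataχSec p (infl κ̈(c))` (CONSTANT Kummer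
  class of a unit `c ≠ ±1`): every `σ ∈ Π^tp_X` fixes `infl κ̈(c)` (Prop. 1.5 (ii) at the section datum), so the
  orbit `η̈^{Θ,Z}` is a singleton for EVERY `ε_Z` and its value at EVERY non-cuspidal point is `c` (`evalAt_kum`):
  `OrbitsOfStandardType C hC ε_Z S` FAILS for all `(hC, ε_Z, S)` and every choice `X̲̲`
  (`forall_not_orbitsOfStandardType_inflKum`). The choice `X̲̲ := Huuχ p l` EXISTS (`E.DoubleUnderline l`, `l` odd)
  whenever `η̈^Θ` is an `l`-th power — the `l`-th power of a representative is an `l·Δ_Θ`-valued representative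
  (`eta_res_of_exists_pow_eq`); with `c := (1+p)^l`, `p ≡ 1 (mod 4)` (so that Def. 1.9 data exist, `√−1 ∈ ℚ_p`):
  `exists_not_orbitsOfStandardType_modelχ` (every odd `l`), and at `p = 5`, `l = 3` the literal closure over ALL
  binders: **`MuTwoSetting.not_forall_orbitsOfStandardType`**.
* (POS) **an instance HOLDS at the model's GENUINE theta class** `E := etaleThetaDataχSec p (etaDdχ p)` (non-trivial,
  `etaDdχ_ne_one`), `C := doubleUnderlineχSec p l hl`, `ε_Z := a`, `τ^{±1} :=` the Galois-section point
  `inr(G_{ℚ_p})` of `Ÿ` RE-LABELLED `√−1^{±1}` (typed `StandardData` leaves `coord` free next to `(D_y, evalAt)` —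
  K2 NOTE N1, as in abc-iut-f-113's tests): the `a`-axis is untwisted (`twist_eta_of_zero`), so `a` commutes with
  the Galois factor, and the theta cocycle `(γ, σ) ↦ θ(γ·b^{−ŷ(γ)})` vanishes at `γ = 1`; hence every orbit member
  `conj_{y·a^k} η̈^Θ` restricts TRIVIALLY to `inr(G_{ℚ_p})`, `valuesAt = {1}`, and the orbits ARE of standard type:
  **`orbitsOfStandardType_etaDdχ`**, headline `MuTwoSetting.exists_kummer_model_orbitsOfStandardType`.
* (DICHOTOMY) `orbitsOfStandardType_independent`: at ONE `(M, hC, ε_Z)` the predicate holds for one étale-theta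
  datum and fails for another — F-0573 is a genuine CONDITION on `E`
  (FACT-LIST reading R5: consumable at NAMED instances, e.g. the `hstd` binder of `Cor219_iii_std`; never ∀-closed;
  cf. abc-iut-f-151's `exists_not_cor219_iii_std`, abc-iut-f-113's `isOfStandardType_testClass_anchored`).
HONEST FRAMING: statements about OUR typing at a SEMI-SYNTHETIC model (the χ-twisted root, not the tempered `π₁` of
a curve; the value `1` of the model's theta class at the Galois-section point is not the printed `Θ̈(√−1)`);
refuting a typed closure ≠ refuting print; nothing of [EtTh] is asserted or denied; a FACT row is an assumption
label; typed ≠ proved; no side is taken on [IUTchIII] Cor. 3.12 or on any author.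
-/
noncomputable section

namespace Literature.AnabelianGeometry.EtaleTheta.SettingModel

open Literature.AnabelianGeometry.SemiGraphs _root_.Function

variable (p : ℕ) [Fact p.Prime]

/-! ### (A) Constant classes: singleton orbit for every `ε_Z`, value `c` at every point -/

/-- A class fixed by EVERY `σ ∈ Π^tp_X` has singleton orbit `η̈^{Θ,Z}`, whatever `ε_Z`. [cite: MochizukiEtTh2009, Def 1.9 p.29] -/
theorem thetaOrbit_eq_singleton_of_forall_conj_eq (hC : (ThetaSetting.modelχ p).Compat)
    (εZ : (MuTwoSetting.modelχ p).GtpC) {x : (ThetaSetting.modelχ p).H1 (ThetaSetting.modelχ p).GtpYdd}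
    (hx : ∀ σ : PiTpχ p, haveI := hC.GtpYdd_normal
      ContH1.conj (ThetaSetting.modelχ p).toTheta (ThetaSetting.modelχ p).DeltaTheta σ x = x) :
    (MuTwoSetting.modelχ p).thetaOrbit hC εZ x = {x} := by
  haveI := hC.GtpYdd_normal
  refine Set.eq_singleton_iff_unique_mem.2 ⟨MuTwoSetting.mem_thetaOrbit_self _ _ _, ?_⟩
  rintro _ ⟨σ, -, rfl⟩
  exact hx σ

/-- **The orbit of a constant Kummer class `infl κ̈(c)` is a singleton**, for every `ε_Z` (every `σ` fixes it,
abc-iut-f-113's `conj_inflTheta_kumYdd_modelχ`). [cite: MochizukiEtTh2009, Def 1.9 p.29] -/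
theorem thetaOrbit_inflKum (hC : (ThetaSetting.modelχ p).Compat) (εZ : (MuTwoSetting.modelχ p).GtpC)
    (c : (↥(ThetaSetting.modelχ p).Kdd)ˣ) :
    (MuTwoSetting.modelχ p).thetaOrbit hC εZ
        ((ThetaSetting.modelχ p).inflTheta (ThetaSetting.modelχ p).GtpYdd
          ((kummerDataχSec p).kumYdd ((kummerDataχSec p).toKddHat c))) =
      {(ThetaSetting.modelχ p).inflTheta (ThetaSetting.modelχ p).GtpYdd
          ((kummerDataχSec p).kumYdd ((kummerDataχSec p).toKddHat c))} :=
  thetaOrbit_eq_singleton_of_forall_conj_eq p hC εZ fun σ => conj_inflTheta_kumYdd_modelχ p hC σ c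

/-- **The set of values of a constant class at ANY non-cuspidal point is `{c}`** (`evalAt_kum`). [cite: MochizukiEtTh2009, Def 1.9 (i) p.29] -/
theorem valuesAt_inflKum (hC : (ThetaSetting.modelχ p).Compat) (εZ : (MuTwoSetting.modelχ p).GtpC)
    (c : (↥(ThetaSetting.modelχ p).Kdd)ˣ) (y₀ : ThetaSetting.NonCuspidalPoint (kummerDataχSec p)) :
    MuTwoSetting.valuesAt (M := MuTwoSetting.modelχ p) hC εZ
        ((ThetaSetting.modelχ p).inflTheta (ThetaSetting.modelχ p).GtpYdd
          ((kummerDataχSec p).kumYdd ((kummerDataχSec p).toKddHat c))) y₀ = {c} :=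
  valuesAt_eq_singleton_of_thetaOrbit_eq p hC εZ (thetaOrbit_inflKum p hC εZ c) y₀ (y₀.evalAt_kum _)

/-- **A constant class `infl κ̈(c)` with `c ≠ ±1` is of standard type for NO Def. 1.9 datum `S`** (both standard
sets of values are `{c}`). [cite: MochizukiEtTh2009, Def 1.9 (ii) p.29] -/
theorem not_isOfStandardType_inflKum (hC : (ThetaSetting.modelχ p).Compat) (εZ : (MuTwoSetting.modelχ p).GtpC)
    {c : (↥(ThetaSetting.modelχ p).Kdd)ˣ} (h1 : ((c : (ThetaSetting.modelχ p).Kdd) : PadicAlgCl p) ≠ 1)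
    (h2 : ((c : (ThetaSetting.modelχ p).Kdd) : PadicAlgCl p) ≠ -1)
    (S : (MuTwoSetting.modelχ p).StandardData (kummerDataχSec p)) :
    ¬ MuTwoSetting.IsOfStandardType (M := MuTwoSetting.modelχ p) hC εZ S
        ((ThetaSetting.modelχ p).inflTheta (ThetaSetting.modelχ p).GtpYdd
          ((kummerDataχSec p).kumYdd ((kummerDataχSec p).toKddHat c))) := by
  rintro ⟨V, hV, v, hv, -, -, hpm⟩
  have hvc : v = c := by
    rcases hV with rfl | rfl <;> rw [valuesAt_inflKum] at hv <;> exact Set.mem_singleton_iff.1 hv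
  subst hvc
  exact hpm.elim h1 h2

/-! ### (B) The choice `X̲̲ := Huuχ p l` for data whose class is an `l`-th power -/

/-- **`eta_res` for `l`-th powers**: if `η̈ = y^l`, then `η̈|_{Π^tp_Ÿ ∩ Π^tp_X̲̲}` is represented by an `l·Δ_Θ`-valued
continuous cocycle — the `l`-th power of any representative of `y|`. [cite: MochizukiEtTh2009, Def 2.7 p.41] -/
theorem eta_res_of_exists_pow_eq (l : ℕ+) {η : (ThetaSetting.modelχ p).H1 (ThetaSetting.modelχ p).GtpYdd}
    (hη : ∃ y : (ThetaSetting.modelχ p).H1 (ThetaSetting.modelχ p).GtpYdd, y ^ (l : ℕ) = η) :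
    ∃ (f : ↥((ThetaSetting.modelχ p).GtpYdd ⊓ Huuχ p l) → (ThetaSetting.modelχ p).DeltaTheta)
      (hf : f ∈ contCocycles (ThetaSetting.modelχ p).toTheta (ThetaSetting.modelχ p).DeltaTheta
        ((ThetaSetting.modelχ p).GtpYdd ⊓ Huuχ p l)),
      (∀ g, (f g : (ThetaSetting.modelχ p).GtpTheta) ∈ (ThetaSetting.modelχ p).lDeltaTheta l) ∧
        ContH1.mk f hf =
          ContH1.res (ThetaSetting.modelχ p).toTheta (ThetaSetting.modelχ p).DeltaTheta inf_le_left
            (etaleThetaDataχSec p η).etaDd := by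
  obtain ⟨y, rfl⟩ := hη
  obtain ⟨g, hg⟩ : ∃ g : contCocycles (ThetaSetting.modelχ p).toTheta (ThetaSetting.modelχ p).DeltaTheta
      ((ThetaSetting.modelχ p).GtpYdd ⊓ Huuχ p l),
      (QuotientGroup.mk g : ContH1 _ _ _) =
        ContH1.res (ThetaSetting.modelχ p).toTheta (ThetaSetting.modelχ p).DeltaTheta
          (inf_le_left : (ThetaSetting.modelχ p).GtpYdd ⊓ Huuχ p l ≤ (ThetaSetting.modelχ p).GtpYdd) y :=
    QuotientGroup.mk_surjective _
  refine ⟨(g ^ (l : ℕ)).1, (g ^ (l : ℕ)).2, fun x => ⟨(g.1 x : (ThetaSetting.modelχ p).GtpTheta), (g.1 x).2, ?_⟩, ?_⟩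
  · change ((g.1 x : ↥(ThetaSetting.modelχ p).DeltaTheta) : (ThetaSetting.modelχ p).GtpTheta) ^ (l : ℕ) =
      ((((g ^ (l : ℕ) : contCocycles _ _ _) : _ → ↥(ThetaSetting.modelχ p).DeltaTheta) x :
          ↥(ThetaSetting.modelχ p).DeltaTheta) : (ThetaSetting.modelχ p).GtpTheta)
    rw [Subgroup.coe_pow, Pi.pow_apply, Subgroup.coe_pow]
  · change (QuotientGroup.mk (g ^ (l : ℕ)) : ContH1 _ _ _) =
      ContH1.res (ThetaSetting.modelχ p).toTheta (ThetaSetting.modelχ p).DeltaTheta inf_le_left (y ^ (l : ℕ))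
    rw [map_pow, ← hg]
    rfl

/-- **The choice `X̲̲ := Huuχ p l` EXISTS for every étale-theta datum over the section datum whose class is an
`l`-th power** (`l` odd; abc-iut-L2-d1's `doubleUnderlineχOfEtaRes`). [cite: MochizukiEtTh2009, Def 2.5 (i) p.39] -/
theorem nonempty_doubleUnderline_etaleThetaDataχSec_of_exists_pow_eq (l : ℕ+) (hl : Odd (l : ℕ))
    {η : (ThetaSetting.modelχ p).H1 (ThetaSetting.modelχ p).GtpYdd}
    (hη : ∃ y : (ThetaSetting.modelχ p).H1 (ThetaSetting.modelχ p).GtpYdd, y ^ (l : ℕ) = η) :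
    Nonempty ((etaleThetaDataχSec p η).DoubleUnderline l) :=
  ⟨ThetaSetting.EtaleThetaData.doubleUnderlineχOfEtaRes p l hl _ (eta_res_of_exists_pow_eq p l hη)⟩

/-- In particular (besides every class at `l = 1`) for the constant class of an `l`-th power `c = d^l`, `l` odd.
[cite: MochizukiEtTh2009, Def 2.5 (i) p.39] -/
theorem nonempty_doubleUnderline_inflKum_pow (l : ℕ+) (hl : Odd (l : ℕ)) (d : (↥(ThetaSetting.modelχ p).Kdd)ˣ) :
    Nonempty ((etaleThetaDataχSec p
      ((ThetaSetting.modelχ p).inflTheta (ThetaSetting.modelχ p).GtpYdd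
        ((kummerDataχSec p).kumYdd ((kummerDataχSec p).toKddHat (d ^ (l : ℕ)))))).DoubleUnderline l) :=
  nonempty_doubleUnderline_etaleThetaDataχSec_of_exists_pow_eq p l hl
    ⟨(ThetaSetting.modelχ p).inflTheta (ThetaSetting.modelχ p).GtpYdd
        ((kummerDataχSec p).kumYdd ((kummerDataχSec p).toKddHat d)), by rw [← map_pow, ← map_pow, ← map_pow]⟩

/-! ### (C) NEG: Def. 2.7 FAILS for the constant-class data — for every `(hC, ε_Z, S, l, C)` -/

/-- **F-0573 FAILS at the constant-class datum**: for a unit `c ≠ ±1`, the orbits derived from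
`E_c := etaleThetaDataχSec p (infl κ̈(c))` are of standard type for NO `(hC, ε_Z, S)` and NO choice `X̲̲`.
[cite: MochizukiEtTh2009, Def 2.7 p.41] -/
theorem forall_not_orbitsOfStandardType_inflKum {c : (↥(ThetaSetting.modelχ p).Kdd)ˣ}
    (h1 : ((c : (ThetaSetting.modelχ p).Kdd) : PadicAlgCl p) ≠ 1)
    (h2 : ((c : (ThetaSetting.modelχ p).Kdd) : PadicAlgCl p) ≠ -1) :
    ∀ (hC : (ThetaSetting.modelχ p).Compat) (εZ : (MuTwoSetting.modelχ p).GtpC) (l : ℕ)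
      (C : (etaleThetaDataχSec p ((ThetaSetting.modelχ p).inflTheta (ThetaSetting.modelχ p).GtpYdd
        ((kummerDataχSec p).kumYdd ((kummerDataχSec p).toKddHat c)))).DoubleUnderline l)
      (S : (MuTwoSetting.modelχ p).StandardData (kummerDataχSec p)),
      ¬ MuTwoSetting.OrbitsOfStandardType (M := MuTwoSetting.modelχ p) C hC εZ S :=
  fun hC εZ _ _ S => not_isOfStandardType_inflKum p hC εZ h1 h2 S

/-- The unit `(1+p)^n ∈ K̈^×` read in `ℚ̄_p` is the natural number `(1+p)^n`, hence `≠ 1` for `n ≠ 0` and `≠ −1`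
(characteristic `0`). [folklore] -/
private theorem coe_onePlusP_pow_ne (n : ℕ) (hn : n ≠ 0) :
    (((onePlusP p ^ n : (↥(ThetaSetting.modelχ p).Kdd)ˣ) : (ThetaSetting.modelχ p).Kdd) : PadicAlgCl p) ≠ 1 ∧
      (((onePlusP p ^ n : (↥(ThetaSetting.modelχ p).Kdd)ˣ) : (ThetaSetting.modelχ p).Kdd) : PadicAlgCl p) ≠ -1 := by
  haveI : CharZero (PadicAlgCl p) := charZero_of_injective_algebraMap (algebraMap ℚ_[p] (PadicAlgCl p)).injective
  have hp1 : 1 < 1 + p := by have := (Fact.out : p.Prime).two_le; omega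
  have hcoe : (((onePlusP p ^ n : (↥(ThetaSetting.modelχ p).Kdd)ˣ) : (ThetaSetting.modelχ p).Kdd) : PadicAlgCl p) =
      (((1 + p) ^ n : ℕ) : PadicAlgCl p) := by
    rw [Units.val_pow_eq_pow_val]; push_cast; rw [coe_onePlusP]
  rw [hcoe]
  constructor
  · intro h
    have h' : ((1 + p) ^ n : ℕ) = 1 := by exact_mod_cast h
    exact (Nat.one_lt_pow hn hp1).ne' h'
  · intro h
    have h' : ((((1 + p) ^ n + 1 : ℕ)) : PadicAlgCl p) = 0 := by push_cast [h]; ring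
    have h'' : (1 + p) ^ n + 1 = 0 := by exact_mod_cast h'
    omega

/-- **Data violating F-0573 at `modelχ`, for every odd `l`** (`p ≡ 1 (mod 4)`, so that Def. 1.9 data exist):
`E := etaleThetaDataχSec p (infl κ̈((1+p)^l))` (class `≠ 1`), `X̲̲ := Huuχ p l`, any `S` (abc-iut-w5-d140's anchored
datum); the predicate fails for ALL `(hC, ε_Z, S')`. [cite: MochizukiEtTh2009, Def 2.7 p.41] -/
theorem exists_not_orbitsOfStandardType_modelχ (hp : p % 4 = 1) (l : ℕ+) (hl : Odd (l : ℕ)) :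
    ∃ (E : (MuTwoSetting.modelχ p).toThetaSetting.EtaleThetaData) (C : E.DoubleUnderline l)
      (_S : (MuTwoSetting.modelχ p).StandardData E.toKummerData),
      E.etaDd ≠ 1 ∧
      ∀ (hC : (MuTwoSetting.modelχ p).toThetaSetting.Compat) (εZ : (MuTwoSetting.modelχ p).GtpC)
        (S : (MuTwoSetting.modelχ p).StandardData E.toKummerData),
        ¬ MuTwoSetting.OrbitsOfStandardType C hC εZ S := by
  have hne := coe_onePlusP_pow_ne p (l : ℕ) l.pos.ne'
  obtain ⟨C⟩ := nonempty_doubleUnderline_inflKum_pow p l hl (onePlusP p)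
  refine ⟨etaleThetaDataχSec p ((ThetaSetting.modelχ p).inflTheta (ThetaSetting.modelχ p).GtpYdd
      ((kummerDataχSec p).kumYdd ((kummerDataχSec p).toKddHat (onePlusP p ^ (l : ℕ))))), C,
    (anchoredStandardDataχ p hp _).toStandardData, ?_, fun hC εZ S => not_isOfStandardType_inflKum p hC εZ hne.1 hne.2 S⟩
  -- the class is non-trivial: its value at the section-point is `(1+p)^l ≠ 1`
  intro h
  have hv := (nonCuspidalPointχ p).evalAt_kum ((kummerDataχSec p).toKddHat (onePlusP p ^ (l : ℕ)))
  change (nonCuspidalPointχ p).evalAt (ContH1.res (ThetaSetting.modelχ p).toTheta (ThetaSetting.modelχ p).DeltaTheta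
      (nonCuspidalPointχ p).Dpt_le
      (etaleThetaDataχSec p ((ThetaSetting.modelχ p).inflTheta (ThetaSetting.modelχ p).GtpYdd
        ((kummerDataχSec p).kumYdd ((kummerDataχSec p).toKddHat (onePlusP p ^ (l : ℕ)))))).etaDd) = _ at hv
  rw [h, map_one, map_one, ← (kummerDataχSec p).toKddHat.map_one] at hv
  have h1 : (1 : (↥(ThetaSetting.modelχ p).Kdd)ˣ) = onePlusP p ^ (l : ℕ) := (kummerDataχSec p).toKddHat_injective hv
  exact hne.1 (by rw [← h1]; rfl)

/-- **THE UNIVERSAL CLOSURE OF F-0573 IS FALSE** (Def. 2.7 as typed, closed over ALL its binders): witness `p = 5`,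
`M := MuTwoSetting.modelχ 5`, `l = 3`, the constant class of `(1+p)^3`. [cite: MochizukiEtTh2009, Def 2.7 p.41] -/
theorem _root_.Literature.AnabelianGeometry.EtaleTheta.MuTwoSetting.not_forall_orbitsOfStandardType :
    ¬ ∀ (p : ℕ) [Fact p.Prime] (M : MuTwoSetting p) (E : M.toThetaSetting.EtaleThetaData) (l : ℕ)
        (C : E.DoubleUnderline l) (hC : M.toThetaSetting.Compat) (εZ : M.GtpC) (S : M.StandardData E.toKummerData),
        MuTwoSetting.OrbitsOfStandardType C hC εZ S := by
  intro h
  haveI : Fact (Nat.Prime 5) := ⟨by norm_num⟩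
  obtain ⟨E, C, S, -, hnot⟩ := exists_not_orbitsOfStandardType_modelχ 5 rfl 3 (by decide)
  exact hnot (MuTwoSetting.modelχ_compat 5) (epsZχ 5) S (h 5 (MuTwoSetting.modelχ 5) E _ C _ _ S)

/-! ### (D) POS: the model's genuine theta class `η̈^Θ = etaDdχ` at the Galois-section point -/

/-- **The `a`-axis is untwisted**: `G_{ℚ_p}` fixes the graph element `gfpOf a` (`θ_u(a) = a`). [cite: MochizukiEtTh2009, §1 p.12] -/
theorem actχ_gfpOf_zero (σ : GQp p) : actχ p σ (gfpOf (FreeGroup.of 0)) = gfpOf (FreeGroup.of 0) := by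
  apply Subtype.ext
  rw [actχ_apply, coe_twistGfp]
  exact Prod.ext (twist_eta_of_zero _) rfl

/-- Hence **`a` commutes with the Galois factor** `inr(G_{ℚ_p})` in `Γ ⋊_χ G_{ℚ_p}`. [cite: MochizukiEtTh2009, §1 p.12] -/
theorem commute_inr_inl_gfpOf_zero (σ : GQp p) :
    Commute (SemidirectProduct.inr σ : PiTpχ p) (SemidirectProduct.inl (gfpOf (FreeGroup.of 0))) := by
  change (SemidirectProduct.inr σ : PiTpχ p) * SemidirectProduct.inl (gfpOf (FreeGroup.of 0)) =
    SemidirectProduct.inl (gfpOf (FreeGroup.of 0)) * SemidirectProduct.inr σ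
  refine SemidirectProduct.ext ?_ ?_
  · rw [SemidirectProduct.mul_left, SemidirectProduct.mul_left, SemidirectProduct.left_inr,
      SemidirectProduct.right_inr, SemidirectProduct.left_inl, SemidirectProduct.right_inl, one_mul, map_one,
      mul_one, actχ_gfpOf_zero]
  · rw [SemidirectProduct.mul_right, SemidirectProduct.mul_right, SemidirectProduct.right_inr,
      SemidirectProduct.right_inl, mul_one, one_mul]

/-- **The theta cocycle vanishes on elements with trivial `Γ`-part** (`centreRep 1 = 1`), in particular on the
Galois factor `inr(G_{ℚ_p})`. [cite: MochizukiEtTh2009, Prop 1.3 p.20] -/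
theorem thetaCocycleFunχ_eq_one_of_left_eq_one (g : ↥(ThetaSetting.modelχ p).GtpY) (hg : (g : PiTpχ p).left = 1) :
    thetaCocycleFunχ p g = 1 := by
  apply Subtype.ext
  rw [coe_thetaCocycleFunχ, hg]
  simp only [centreRep, map_one, inv_one, mul_one, OneMemClass.coe_one]

/-- **Every deck-translate `conj_{a^k} η̈^Θ` of the model's theta class restricts TRIVIALLY to (a subgroup of) the
Galois factor**: `a^{-k}·inr(ρ)·a^{k} = inr(ρ)` and the cocycle vanishes there. [cite: MochizukiEtTh2009, Def 1.9 p.29] -/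
theorem res_conj_zpow_genA_etaDdχ_eq_one (hC : (ThetaSetting.modelχ p).Compat) {D : Subgroup (PiTpχ p)}
    (hD : D ≤ (ThetaSetting.modelχ p).GKdd.map (SemidirectProduct.inr : GQp p →* PiTpχ p))
    (hle : D ≤ (ThetaSetting.modelχ p).GtpYdd) (k : ℤ) :
    haveI := hC.GtpYdd_normal
    ContH1.res (ThetaSetting.modelχ p).toTheta (ThetaSetting.modelχ p).DeltaTheta hle
      (ContH1.conj (ThetaSetting.modelχ p).toTheta (ThetaSetting.modelχ p).DeltaTheta
        ((SemidirectProduct.inl (gfpOf (FreeGroup.of 0)) : PiTpχ p) ^ k) (etaDdχ p)) = 1 := by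
  haveI := hC.GtpYdd_normal
  set A : PiTpχ p := SemidirectProduct.inl (gfpOf (FreeGroup.of 0))
  set g₀ := ContH1.resCocycle (ThetaSetting.modelχ p).toTheta (ThetaSetting.modelχ p).DeltaTheta
    (ThetaSetting.modelχ p).GtpYdd_le_GtpY (thetaCocycleχ p)
  have h1 : etaDdχ p = (QuotientGroup.mk g₀ : ContH1 _ _ _) := rfl
  rw [h1, ContH1.conj_mk]
  change (QuotientGroup.mk (ContH1.resCocycle (ThetaSetting.modelχ p).toTheta (ThetaSetting.modelχ p).DeltaTheta hle
      (ContH1.conjCocycle (ThetaSetting.modelχ p).toTheta (ThetaSetting.modelχ p).DeltaTheta (A ^ k) g₀)) :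
        ContH1 _ _ _) = 1
  have hcocycle : ContH1.resCocycle (ThetaSetting.modelχ p).toTheta (ThetaSetting.modelχ p).DeltaTheta hle
      (ContH1.conjCocycle (ThetaSetting.modelχ p).toTheta (ThetaSetting.modelχ p).DeltaTheta (A ^ k) g₀) = 1 := by
    apply Subtype.ext
    funext x
    -- `x = inr ρ`, and `a^{-k} x a^{k} = x`
    obtain ⟨ρ, -, hρ⟩ := Subgroup.mem_map.1 (hD x.2)
    have hcomm : Commute (x : PiTpχ p) (A ^ k) := by
      rw [← hρ]
      exact (commute_inr_inl_gfpOf_zero p ρ).zpow_right k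
    have hfix : (((MulAut.conjNormal (A ^ k)⁻¹) (⟨(x : PiTpχ p), hle x.2⟩ : ↥(ThetaSetting.modelχ p).GtpYdd) :
        ↥(ThetaSetting.modelχ p).GtpYdd) : PiTpχ p) = x := by
      rw [MulAut.conjNormal_apply, inv_inv, Subgroup.coe_mk, mul_assoc, hcomm.eq, ← mul_assoc, inv_mul_cancel,
        one_mul]
    have hleft : ((((MulAut.conjNormal (A ^ k)⁻¹) (⟨(x : PiTpχ p), hle x.2⟩ : ↥(ThetaSetting.modelχ p).GtpYdd) :
        ↥(ThetaSetting.modelχ p).GtpYdd) : PiTpχ p)).left = 1 := by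
      rw [hfix, ← hρ, SemidirectProduct.left_inr]
    change MulAut.conjNormal ((ThetaSetting.modelχ p).toTheta (A ^ k))
        (thetaCocycleFunχ p ⟨_, (ThetaSetting.modelχ p).GtpYdd_le_GtpY
          ((MulAut.conjNormal (A ^ k)⁻¹) (⟨(x : PiTpχ p), hle x.2⟩ : ↥(ThetaSetting.modelχ p).GtpYdd)).2⟩) = 1
    rw [thetaCocycleFunχ_eq_one_of_left_eq_one p _ hleft, map_one]
  rw [hcocycle]
  rfl

/-- **Every member of the orbit `η̈^{Θ,Z}` (`ε_Z := a`) of the model's theta class restricts trivially to the Galois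
factor**: the members are `conj_{y·a^k} η̈^Θ`, `y ∈ Π^tp_Ÿ` acting innerly. [cite: MochizukiEtTh2009, Def 1.9 p.29] -/
theorem res_eq_one_of_mem_thetaOrbit_etaDdχ (hC : (ThetaSetting.modelχ p).Compat) {D : Subgroup (PiTpχ p)}
    (hD : D ≤ (ThetaSetting.modelχ p).GKdd.map (SemidirectProduct.inr : GQp p →* PiTpχ p))
    (hle : D ≤ (ThetaSetting.modelχ p).GtpYdd) {y : (ThetaSetting.modelχ p).H1 (ThetaSetting.modelχ p).GtpYdd}
    (hy : y ∈ (MuTwoSetting.modelχ p).thetaOrbit hC (epsZχ p) (etaDdχ p)) :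
    ContH1.res (ThetaSetting.modelχ p).toTheta (ThetaSetting.modelχ p).DeltaTheta hle y = 1 := by
  haveI := hC.GtpYdd_normal
  obtain ⟨σ, hσ, rfl⟩ := hy
  obtain ⟨y', hy', k, rfl⟩ := exists_eq_mul_zpow_of_inclX_mem_dotX p hσ
  change ContH1.res _ _ hle (ContH1.conj (ThetaSetting.modelχ p).toTheta (ThetaSetting.modelχ p).DeltaTheta
      (y' * (SemidirectProduct.inl (gfpOf (FreeGroup.of 0)) : PiTpχ p) ^ k) (etaDdχ p)) = 1
  rw [ContH1.conj_mul_apply, ContH1.conj_eq_self_of_mem y' hy']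
  exact res_conj_zpow_genA_etaDdχ_eq_one p hC hD hle k

/-- **The set of values of the model's theta class at a Galois-section point is `{1}`.** [cite: MochizukiEtTh2009, Def 1.9 (i) p.29] -/
theorem valuesAt_etaDdχ_eq_singleton_one (hC : (ThetaSetting.modelχ p).Compat)
    (y₀ : ThetaSetting.NonCuspidalPoint (kummerDataχSec p))
    (hD : y₀.Dpt ≤ (ThetaSetting.modelχ p).GKdd.map (SemidirectProduct.inr : GQp p →* PiTpχ p)) :
    MuTwoSetting.valuesAt (M := MuTwoSetting.modelχ p) hC (epsZχ p) (etaDdχ p) y₀ = {1} := by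
  refine Set.eq_singleton_iff_unique_mem.2 ⟨⟨etaDdχ p, MuTwoSetting.mem_thetaOrbit_self _ _ _, ?_⟩, ?_⟩
  · rw [res_eq_one_of_mem_thetaOrbit_etaDdχ p hC hD y₀.Dpt_le (MuTwoSetting.mem_thetaOrbit_self _ _ _), map_one,
      map_one]
  · rintro v ⟨y, hy, hyv⟩
    rw [res_eq_one_of_mem_thetaOrbit_etaDdχ p hC hD y₀.Dpt_le hy, map_one] at hyv
    exact (kummerDataχSec p).toKddHat_injective (by rw [map_one]; exact hyv.symm)

/-- **F-0573 HOLDS at the model's GENUINE theta class** (`p ≡ 1 (mod 4)`): for the Def. 1.9 datum `S` whose `τ^{±1}`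
are the Galois-section point `inr(G_{ℚ_p})` of `Ÿ` labelled `√−1^{±1}`, the orbits `η̈^{Θ,l·ℤ}, …, η̈^{Θ,ℤ×μ₂}` derived
from `η̈^Θ := etaDdχ p` ARE of standard type (unique value `1` at `τ`) — for every `hC` and EVERY choice `X̲̲`
(inhabited for odd `l`: abc-iut-L2-d1's `doubleUnderlineχSec`). [cite: MochizukiEtTh2009, Def 2.7 p.41] -/
theorem orbitsOfStandardType_etaDdχ (hp : p % 4 = 1) :
    ∃ S : (MuTwoSetting.modelχ p).StandardData (kummerDataχSec p),
      S.tau.Dpt = (ThetaSetting.modelχ p).GKdd.map (SemidirectProduct.inr : GQp p →* PiTpχ p) ∧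
      ((S.tau.coord : (ThetaSetting.modelχ p).Kdd) : PadicAlgCl p) = sqrtNegOneχ p hp ∧
      (∀ hC : (ThetaSetting.modelχ p).Compat,
        MuTwoSetting.valuesAt (M := MuTwoSetting.modelχ p) hC (epsZχ p) (etaDdχ p) S.tau = {1} ∧
        MuTwoSetting.valuesAt (M := MuTwoSetting.modelχ p) hC (epsZχ p) (etaDdχ p) S.tauInv = {1}) ∧
      ∀ (hC : (ThetaSetting.modelχ p).Compat) (l : ℕ) (C : (etaleThetaDataχSec p (etaDdχ p)).DoubleUnderline l),
        MuTwoSetting.OrbitsOfStandardType (M := MuTwoSetting.modelχ p) C hC (epsZχ p) S := by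
  let τ₁ : ThetaSetting.NonCuspidalPoint (kummerDataχSec p) :=
    { nonCuspidalPointχ p with
      coord := sqrtNegOneUnitχ p hp
      coord_ne_cusp := sqrtNegOneUnitχ_ne_cusp p hp }
  let τ₂ : ThetaSetting.NonCuspidalPoint (kummerDataχSec p) :=
    { nonCuspidalPointχ p with
      coord := sqrtNegOneInvUnitχ p hp
      coord_ne_cusp := sqrtNegOneInvUnitχ_ne_cusp p hp }
  have hD₁ : τ₁.Dpt ≤ (ThetaSetting.modelχ p).GKdd.map (SemidirectProduct.inr : GQp p →* PiTpχ p) := le_rfl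
  have hD₂ : τ₂.Dpt ≤ (ThetaSetting.modelχ p).GKdd.map (SemidirectProduct.inr : GQp p →* PiTpχ p) := le_rfl
  refine ⟨{ sqrtNegOne := sqrtNegOneχ p hp
            sqrtNegOne_mem := sqrtNegOneχ_mem_K p hp
            sqrtNegOne_sq := sqrtNegOneχ_sq p hp
            tau := τ₁
            tauInv := τ₂
            tau_coord := coe_sqrtNegOneUnitχ p hp
            tauInv_coord := coe_sqrtNegOneInvUnitχ p hp }, rfl, coe_sqrtNegOneUnitχ p hp,
    fun hC => ⟨valuesAt_etaDdχ_eq_singleton_one p hC τ₁ hD₁, valuesAt_etaDdχ_eq_singleton_one p hC τ₂ hD₂⟩,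
    fun hC l C => ?_⟩
  refine ⟨_, Or.inl rfl, 1, ?_, ?_, one_mem _, Or.inl rfl⟩
  · change (1 : (↥(ThetaSetting.modelχ p).Kdd)ˣ) ∈
      MuTwoSetting.valuesAt (M := MuTwoSetting.modelχ p) hC (epsZχ p) (etaDdχ p) τ₁
    rw [valuesAt_etaDdχ_eq_singleton_one p hC τ₁ hD₁]
    exact Set.mem_singleton 1
  · intro w hw
    change w ∈ MuTwoSetting.valuesAt (M := MuTwoSetting.modelχ p) hC (epsZχ p) (etaDdχ p) τ₁ at hw
    rw [valuesAt_etaDdχ_eq_singleton_one p hC τ₁ hD₁, Set.mem_singleton_iff] at hw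
    rw [hw]

/-- **Census headline — F-0573's instance form is INHABITED, NON-VACUOUSLY, at a Kummer-carrying model, for the
model's OWN (non-trivial) theta class.** [cite: MochizukiEtTh2009, Def 2.7 p.41] -/
theorem _root_.Literature.AnabelianGeometry.EtaleTheta.MuTwoSetting.exists_kummer_model_orbitsOfStandardType
    (hp : p % 4 = 1) (l : ℕ+) (hl : Odd (l : ℕ)) :
    ∃ (M : MuTwoSetting p) (E : M.toThetaSetting.EtaleThetaData) (C : E.DoubleUnderline l)
      (hC : M.toThetaSetting.Compat) (εZ : M.GtpC) (S : M.StandardData E.toKummerData),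
      M.toThetaSetting.IsEtThOrigin ∧ M.IsAdmissibleEpsZ εZ ∧ E.etaDd ≠ 1 ∧
        MuTwoSetting.OrbitsOfStandardType C hC εZ S := by
  obtain ⟨S, -, -, -, hS⟩ := orbitsOfStandardType_etaDdχ p hp
  exact ⟨MuTwoSetting.modelχ p, etaleThetaDataχSec p (etaDdχ p), doubleUnderlineχSec p l hl,
    MuTwoSetting.modelχ_compat p, epsZχ p, S, MuTwoSetting.modelχ_isEtThOrigin p,
    MuTwoSetting.modelχ_isAdmissibleEpsZ p, etaDdχ_ne_one p, hS _ _ _⟩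

/-! ### (E) DICHOTOMY: Def. 2.7 is a genuine condition on the étale-theta datum -/

/-- **INDEPENDENCE of F-0573 from the Def. 1.7 / 2.5 interface**: at ONE `(M, hC, ε_Z)` (the χ-model, `ε_Z := a`,
`p ≡ 1 (mod 4)`, any odd `l`) some étale-theta datum with a choice `X̲̲` and a Def. 1.9 datum HAS orbits of standard
type (the model's theta class) and another has NOT, whatever `(X̲̲, S)` (a constant class `≠ ±1`).
[cite: MochizukiEtTh2009, Def 2.7 p.41] -/
theorem orbitsOfStandardType_independent (hp : p % 4 = 1) (l : ℕ+) (hl : Odd (l : ℕ)) :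
    (∃ (E : (MuTwoSetting.modelχ p).toThetaSetting.EtaleThetaData) (C : E.DoubleUnderline l)
        (S : (MuTwoSetting.modelχ p).StandardData E.toKummerData),
        E.etaDd ≠ 1 ∧ MuTwoSetting.OrbitsOfStandardType C (MuTwoSetting.modelχ_compat p) (epsZχ p) S) ∧
    (∃ (E : (MuTwoSetting.modelχ p).toThetaSetting.EtaleThetaData) (_C : E.DoubleUnderline l)
        (_S : (MuTwoSetting.modelχ p).StandardData E.toKummerData),
        E.etaDd ≠ 1 ∧ ∀ (C : E.DoubleUnderline l) (S : (MuTwoSetting.modelχ p).StandardData E.toKummerData),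
          ¬ MuTwoSetting.OrbitsOfStandardType C (MuTwoSetting.modelχ_compat p) (epsZχ p) S) := by
  constructor
  · obtain ⟨S, -, -, -, hS⟩ := orbitsOfStandardType_etaDdχ p hp
    exact ⟨etaleThetaDataχSec p (etaDdχ p), doubleUnderlineχSec p l hl, S, etaDdχ_ne_one p, hS _ _ _⟩
  · obtain ⟨E, C, S, hE, hnot⟩ := exists_not_orbitsOfStandardType_modelχ p hp l hl
    exact ⟨E, C, S, hE, fun C' S' => hnot _ _ S'⟩

end Literature.AnabelianGeometry.EtaleTheta.SettingModel
end
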